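/-
Copyright (c) 2026 the pub-hodgecm-mathlib formalisation cell (harness21).  Prover seat hodgecm-mathlib-K2E5-p16 (g7), Track B «K2-LIT»,
#184♮ = hLiu418 = `stmt-HodgeConjecture-24832`; #41 middle term, cut (u-0c) I3 `K2LiuSiegelMiddleTermKTypes` (LEAD F0P6-plan (g14) BATCH #50 (4); bytes desk
K2Liu-p02 (g7) CENSUS a9fb81f54a0bfc2e; consumer ★ (β0-4)′ p861557 `exists_middle_package_of_faces'`).  THEOREMS ONLY (no `def`, no `instance`, no notation,
no named-fact hypothesis, no `sorry`).
-/
import Summits.HodgeConjecture.HodgeConjecture.Theorems.K2LiuGL2FlatExtension          -- ★ (β0-ext) `exists_flat_extension`, `ideleNorm_borelDiag_eq_one_of_mem_maximalCompact` (+ ★ `exists_glDiagonal_mul_of_mem_standardParabolicGL`)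
import Summits.HodgeConjecture.HodgeConjecture.Theorems.K2LiuGL2FlatSectionFiniteData   -- ★ (β4-v) D2a `ofFinite_mem` (the level letter's membership)
import HarnessLib

/-!
# Crux `HLiu418`, #41 middle term, (u-0c) I3: THE `K`-TYPES OF THE UNTWISTED INNER FAMILY — the `W`-package and `hφW`, `hφbd` of ★ (β0-4)′ FROM A FINITE `K_H`-TYPE

Cell `hodgecm-mathlib`, crux item hLiu418 = `stmt-HodgeConjecture-24832` (helper lane `--supports`, count-neutral).  The abstract `K_H`-finiteness step of
★ (β0-3) `K2LiuMiddleInnerSectionFlatCoords`' WHY-paragraph, hypothesis-first in the (β0) currency.  SETTING: `K = standardMaximalCompactGL 2 L`, a family of the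
TWO-CONSTANT SHAPE of ★ (β0-hol) `differentiableOn_phi₂`, `φ s x g = a g · b x · F s (Λ g · k_x)` (`a = ξ(det ·)⁻¹`, `b x = ξ(det m_x)`, `Λ` the Levi embedding into
`H`, `k_x ∈ K_H` the compact Iwasawa coordinate), with the consumer's flat torus law `hφT` and unipotent invariance `hφN`.  INPUT BY VALUE («`f` is standard»): a FINITE
`K_H`-TYPE of `F` — coefficient functions `c_j : H → ℂ` with the matrix-coefficient law `c_j(h k₁) = Σ_l M_{jl}(k₁) c_l(h)` (`k₁ ∈ K_H`), scalar families `G_j` continuous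
on `{0 < re}`, and `F s h = Σ_j c_j(h) G_j(s)` on `K_H` (at the datum: matrix coefficients of `K_H` on the span of the `K_H`-translates of the standard section, and the
inner sections of a basis at `1`); continuity, norm bounds and the level invariance of `a` and `c_l ∘ Λ` on `K`; the height bound of `b`.
* §1 `borel_compact_law_of_flat` — a function on `GL₂(𝔸_L)` with a flat torus law and unipotent invariance has the `B ∩ K`-law `φ(p k) = φ(k)` (`p ∈ K` upper triangular:
  `p = diag(d)·u`, ★ `exists_glDiagonal_mul_of_mem_standardParabolicGL`, and `|d_i|_𝔸 = 1` on `B ∩ K`, ★ `ideleNorm_borelDiag_eq_one_of_mem_maximalCompact`);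
* §2 `re_pos_of_dist_lt`, `exists_bound_of_continuousOn_halfBall` — the half-ball `dist s z < re z ∕ 2` lies in `{0 < re}` and a function continuous on `{0 < re}` is
  bounded on it;
* §3 **`exists_KTypes_package`** — OUTPUT = ★ (β0-4)′'s binders VERBATIM: `∃ (W ≤ (K → ℂ)) (_ : FiniteDimensional ℂ W), hWstab ∧ hWlaw ∧ hWlev ∧ hWcont ∧ hWext ∧ hφW ∧ hφbd`
  with `W := span{k ↦ a k · c_l(Λ k)} ⊓ {B | B ∩ K-law}` (`hWext` := ★ `exists_flat_extension`; `hφhol` stays ★ `differentiableOn_phi₂`).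
References: [MoeglinWaldspurger1995, I.2.1, II.1.7, IV.1.9]; [Bump1997, §3.7]; [CogdellAnalyticTheory2004, §2.3]; [BorelJacquet1979, §4.1].
HONEST LABEL: HC_CM is proved only modulo the 7 printed citations (2 remaining named inputs: hLiu418 = stmt-HodgeConjecture-24832,
h413 = stmt-HodgeConjecture-24833) until rung 0 closes; count-neutral helper, closes no socket.
-/

set_option autoImplicit false
set_option linter.dupNamespace false

noncomputable section

open NumberField IsDedekindDomain Set Filter Topology Metric
open scoped NNReal Matrix Classical
open Literature.NumberTheory.Automorphic
open Summit.HodgeConjecture.HodgeConjecture.Cruxes.HLiu418.K2LiuGL2FlatSectionFiniteData (ofFinite_mem)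
open Summit.HodgeConjecture.HodgeConjecture.Cruxes.HLiu418.K2LiuGL2GodementSectionsExhaustGlobal (exists_glDiagonal_mul_of_mem_standardParabolicGL)
open Summit.HodgeConjecture.HodgeConjecture.Cruxes.HLiu418.K2LiuGL2FlatExtension (exists_flat_extension ideleNorm_borelDiag_eq_one_of_mem_maximalCompact)

namespace Summit.HodgeConjecture.HodgeConjecture.Cruxes.HLiu418.K2LiuSiegelMiddleTermKTypes

variable {L : Type} [Field L] [NumberField L]

/-! ## §1 The `B ∩ K`-law from the flat torus law and unipotent invariance -/

/-- **the `B ∩ K`-law of a flat function**: if `φ₀ (diag(d) g) = |d₀|^e |d₁|^{e′} φ₀ g` and `φ₀ (u g) = φ₀ g` for unipotent upper triangular `u`, then `φ₀ (p k) = φ₀ k` for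
every upper triangular `p ∈ K` (`p = diag(d)·u`, ★ `exists_glDiagonal_mul_of_mem_standardParabolicGL`; `|d₀|_𝔸 = |d₁|_𝔸 = 1` on `B ∩ K`,
★ `ideleNorm_borelDiag_eq_one_of_mem_maximalCompact`). [cite: Bump1997, §3.7] [cite: MoeglinWaldspurger1995, I.2.1] -/
theorem borel_compact_law_of_flat (φ₀ : GL (Fin 2) (AdeleRing (𝓞 L) L) → ℂ) (e e' : ℂ)
    (hT : ∀ (d : Fin 2 → (AdeleRing (𝓞 L) L)ˣ) (g : GL (Fin 2) (AdeleRing (𝓞 L) L)),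
      φ₀ (glDiagonal 2 (AdeleRing (𝓞 L) L) d * g) = ((IdeleClassGroup.ideleNorm L (d 0) : ℝ) : ℂ) ^ e * ((IdeleClassGroup.ideleNorm L (d 1) : ℝ) : ℂ) ^ e' * φ₀ g)
    (hN : ∀ u g : GL (Fin 2) (AdeleRing (𝓞 L) L), (u : Matrix (Fin 2) (Fin 2) (AdeleRing (𝓞 L) L)) 1 0 = 0 → (u : Matrix (Fin 2) (Fin 2) (AdeleRing (𝓞 L) L)) 0 0 = 1 → (u : Matrix (Fin 2) (Fin 2) (AdeleRing (𝓞 L) L)) 1 1 = 1 → φ₀ (u * g) = φ₀ g)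
    (p k : ↥(standardMaximalCompactGL 2 L)) (hp : ((p : GL (Fin 2) (AdeleRing (𝓞 L) L)) : Matrix (Fin 2) (Fin 2) (AdeleRing (𝓞 L) L)) 1 0 = 0) : φ₀ ((p : GL (Fin 2) (AdeleRing (𝓞 L) L)) * k) = φ₀ k := by
  have hpB : (p : GL (Fin 2) (AdeleRing (𝓞 L) L)) ∈ standardParabolicGL (AdeleRing (𝓞 L) L) (id : Fin 2 → Fin 2) := mem_standardParabolicGL_fin_two_iff.2 hp
  obtain ⟨d, u, hu10, hu00, hu11, hd0, hd1, hpdu⟩ := exists_glDiagonal_mul_of_mem_standardParabolicGL hpB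
  -- `|d₀|_𝔸 = |d₁|_𝔸 = 1`: `d = borelDiagGL2 p` and `p ∈ B ∩ K`
  obtain ⟨h0, h1⟩ := ideleNorm_borelDiag_eq_one_of_mem_maximalCompact ⟨(p : GL (Fin 2) (AdeleRing (𝓞 L) L)), hpB⟩ p.2
  have hd0' : d 0 = (borelDiagGL2 (⟨(p : GL (Fin 2) (AdeleRing (𝓞 L) L)), hpB⟩ : ↥(standardParabolicGL (AdeleRing (𝓞 L) L) (id : Fin 2 → Fin 2)))).1 :=
    Units.ext (by rw [hd0, coe_borelDiagGL2_fst])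
  have hd1' : d 1 = (borelDiagGL2 (⟨(p : GL (Fin 2) (AdeleRing (𝓞 L) L)), hpB⟩ : ↥(standardParabolicGL (AdeleRing (𝓞 L) L) (id : Fin 2 → Fin 2)))).2 :=
    Units.ext (by rw [hd1, coe_borelDiagGL2_snd])
  rw [hpdu, mul_assoc, hT, hN u k hu10 hu00 hu11, hd0', hd1', h0, h1, NNReal.coe_one, Complex.ofReal_one, Complex.one_cpow, Complex.one_cpow, one_mul, one_mul]

/-! ## §2 Half-balls in the right half-plane -/

/-- on the half-ball `dist s z < re z ∕ 2` the real part stays positive: `re z ∕ 2 < re s`. [folklore] -/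
theorem re_half_lt_re_of_dist_le {z s : ℂ} (hs : dist s z ≤ z.re / 2) : z.re / 2 ≤ s.re := by
  have h : |(s - z).re| ≤ ‖s - z‖ := Complex.abs_re_le_norm (s - z)
  rw [Complex.sub_re, ← dist_eq_norm] at h
  have h' := (abs_le.1 (h.trans hs)).1
  linarith

/-- a function continuous on `{0 < re}` is bounded on the closed half-ball `dist s z ≤ re z ∕ 2` (`0 < re z`). [folklore] -/
theorem exists_bound_of_continuousOn_halfBall {G : ℂ → ℂ} (hG : ContinuousOn G {s : ℂ | 0 < s.re}) {z : ℂ} (hz : 0 < z.re) :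
    ∃ C : ℝ, 0 ≤ C ∧ ∀ s : ℂ, dist s z ≤ z.re / 2 → ‖G s‖ ≤ C := by
  have hsub : closedBall z (z.re / 2) ⊆ {s : ℂ | 0 < s.re} := fun s hs =>
    lt_of_lt_of_le (half_pos hz) (re_half_lt_re_of_dist_le (mem_closedBall.1 hs))
  obtain ⟨C, hC⟩ := (isCompact_closedBall z (z.re / 2)).exists_bound_of_continuousOn (hG.mono hsub)
  exact ⟨max C 0, le_max_right _ _, fun s hs => (hC s (mem_closedBall.2 hs)).trans (le_max_left _ _)⟩

/-! ## §3 The `W`-package and `hφW`, `hφbd` from a finite `K_H`-type -/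

/-- **(u-0c) I3 — THE `K`-TYPES OF THE UNTWISTED INNER FAMILY.**  For `φ s x g = a g · b x · F s (Λ g · k_x)` with the flat torus law and unipotent invariance, a finite
`K_H`-type of `F` (`F s h = Σ_j c_j(h) G_j(s)` on `K_H`, `c_j(h k₁) = Σ_l M_{jl}(k₁) c_l(h)`), continuous∕bounded∕level-invariant `a` and `c_l ∘ Λ` on `K`, and
`‖b x‖ ≤ C₀ · height x ^ A₀`: the space **`W := span{k ↦ a k · c_l(Λ k)} ⊓ {B | B(p k) = B(k), p ∈ K upper triangular}`** is finite-dimensional, right-`K`-stable, has the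
`B ∩ K`-law, the level, continuous members and flat extensions (★ `exists_flat_extension`), contains every `φ(s, x)|_K` (`0 < re s`), and
`‖φ s x k‖ ≤ C · height x ^ A₀` locally uniformly in `s` — ★ (β0-4)′ `exists_middle_package_of_faces'`'s binders `W hWstab hWlaw hWlev hWcont hWext` and `hφW hφbd` VERBATIM.
[cite: MoeglinWaldspurger1995, II.1.7, IV.1.9] [cite: Bump1997, §3.7] [cite: CogdellAnalyticTheory2004, §2.3] -/
theorem exists_KTypes_package
    (S : Finset (HeightOneSpectrum (𝓞 L))) (γl : ∀ v : HeightOneSpectrum (𝓞 L), ValuativeRel.ValueGroupWithZero (v.adicCompletion L))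
    {X : Type*} (height : X → ℝ) (hpos : ∀ x, 0 < height x)
    {H : Type*} [Group H] (KH : Subgroup H)
    (F : ℂ → H → ℂ) (a : GL (Fin 2) (AdeleRing (𝓞 L) L) → ℂ) (b : X → ℂ) (Λ : GL (Fin 2) (AdeleRing (𝓞 L) L) → H) (kx : X → H)
    (φ : ℂ → X → GL (Fin 2) (AdeleRing (𝓞 L) L) → ℂ) (hφ : ∀ s x g, φ s x g = a g * b x * F s (Λ g * kx x))
    (hφT : ∀ (s : ℂ) (x : X), 0 < s.re → ∀ (d : Fin 2 → (AdeleRing (𝓞 L) L)ˣ) (g : GL (Fin 2) (AdeleRing (𝓞 L) L)),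
      φ s x (glDiagonal 2 (AdeleRing (𝓞 L) L) d * g) =
      ((IdeleClassGroup.ideleNorm L (d 0) : ℝ) : ℂ) ^ (s + 1 / 2) * ((IdeleClassGroup.ideleNorm L (d 1) : ℝ) : ℂ) ^ (-(s + 1 / 2)) * φ s x g)
    (hφN : ∀ (s : ℂ) (x : X), 0 < s.re → ∀ u g : GL (Fin 2) (AdeleRing (𝓞 L) L), (u : Matrix (Fin 2) (Fin 2) (AdeleRing (𝓞 L) L)) 1 0 = 0 →
      (u : Matrix (Fin 2) (Fin 2) (AdeleRing (𝓞 L) L)) 0 0 = 1 → (u : Matrix (Fin 2) (Fin 2) (AdeleRing (𝓞 L) L)) 1 1 = 1 → φ s x (u * g) = φ s x g)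
    (hΛK : ∀ k : ↥(standardMaximalCompactGL 2 L), Λ k ∈ KH) (hΛmul : ∀ k k₀ : ↥(standardMaximalCompactGL 2 L), Λ ((k * k₀ : ↥(standardMaximalCompactGL 2 L)) : GL (Fin 2) (AdeleRing (𝓞 L) L)) = Λ k * Λ k₀) (hkx : ∀ x, kx x ∈ KH)
    {ι : Type} [Fintype ι] (c : ι → H → ℂ) (M : ι → ι → H → ℂ) (G : ι → ℂ → ℂ)
    (hcM : ∀ (j : ι) (h k₁ : H), k₁ ∈ KH → c j (h * k₁) = ∑ l, M j l k₁ * c l h)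
    (hF : ∀ s : ℂ, 0 < s.re → ∀ h ∈ KH, F s h = ∑ j, c j h * G j s)
    (hG : ∀ j, ContinuousOn (G j) {s : ℂ | 0 < s.re})
    (ha_cont : Continuous fun k : ↥(standardMaximalCompactGL 2 L) => a k) (hc_cont : ∀ l, Continuous fun k : ↥(standardMaximalCompactGL 2 L) => c l (Λ k))
    (ha_mul : ∀ k k₀ : ↥(standardMaximalCompactGL 2 L), a ((k * k₀ : ↥(standardMaximalCompactGL 2 L)) : GL (Fin 2) (AdeleRing (𝓞 L) L)) = a k * a k₀)
    {Ca Cc CM C₀ A₀ : ℝ} (hCa : ∀ k : ↥(standardMaximalCompactGL 2 L), ‖a k‖ ≤ Ca) (hCc : ∀ (l : ι) (k : ↥(standardMaximalCompactGL 2 L)), ‖c l (Λ k)‖ ≤ Cc)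
    (hCM : ∀ (j l : ι) (k₁ : H), k₁ ∈ KH → ‖M j l k₁‖ ≤ CM) (hA₀ : 0 ≤ A₀) (hb : ∀ x, ‖b x‖ ≤ C₀ * height x ^ A₀)
    (ha_lev : ∀ (k : ↥(standardMaximalCompactGL 2 L)) (r : GL (Fin 2) (FiniteAdeleRing (𝓞 L) L)), r ∈ glFiniteIntegralLevel 2 L →
      (∀ v ∈ S, GLn.evalAt 2 L v r ∈ congruenceGL 2 (γl v)) → a ((k : GL (Fin 2) (AdeleRing (𝓞 L) L)) * GLn.ofFinite 2 L r) = a k)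
    (hc_lev : ∀ (l : ι) (k : ↥(standardMaximalCompactGL 2 L)) (r : GL (Fin 2) (FiniteAdeleRing (𝓞 L) L)), r ∈ glFiniteIntegralLevel 2 L →
      (∀ v ∈ S, GLn.evalAt 2 L v r ∈ congruenceGL 2 (γl v)) → c l (Λ ((k : GL (Fin 2) (AdeleRing (𝓞 L) L)) * GLn.ofFinite 2 L r)) = c l (Λ k)) :
    ∃ (W : Submodule ℂ (↥(standardMaximalCompactGL 2 L) → ℂ)) (_ : FiniteDimensional ℂ W),
      (∀ B ∈ W, ∀ k₀ : ↥(standardMaximalCompactGL 2 L), (fun k => B (k * k₀)) ∈ W) ∧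
      (∀ B ∈ W, ∀ p k : ↥(standardMaximalCompactGL 2 L),
        ((p : GL (Fin 2) (AdeleRing (𝓞 L) L)) : Matrix (Fin 2) (Fin 2) (AdeleRing (𝓞 L) L)) 1 0 = 0 → B (p * k) = B k) ∧
      (∀ B ∈ W, ∀ (k : ↥(standardMaximalCompactGL 2 L)) (r : GL (Fin 2) (FiniteAdeleRing (𝓞 L) L)) (hr : r ∈ glFiniteIntegralLevel 2 L),
        (∀ v ∈ S, GLn.evalAt 2 L v r ∈ congruenceGL 2 (γl v)) →
        B ⟨(k : GL (Fin 2) (AdeleRing (𝓞 L) L)) * GLn.ofFinite 2 L r, (standardMaximalCompactGL 2 L).mul_mem k.2 (ofFinite_mem hr)⟩ = B k) ∧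
      (∀ B ∈ W, Continuous B) ∧
      (∀ B ∈ W, ∃ bB : ℂ → GL (Fin 2) (AdeleRing (𝓞 L) L) → ℂ,
        (∀ s : ℂ, 0 < s.re → ∀ (d : Fin 2 → (AdeleRing (𝓞 L) L)ˣ) (g : GL (Fin 2) (AdeleRing (𝓞 L) L)),
        bB s (glDiagonal 2 (AdeleRing (𝓞 L) L) d * g) =
        ((IdeleClassGroup.ideleNorm L (d 0) : ℝ) : ℂ) ^ (s + 1 / 2) * ((IdeleClassGroup.ideleNorm L (d 1) : ℝ) : ℂ) ^ (-(s + 1 / 2)) * bB s g) ∧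
        (∀ s : ℂ, 0 < s.re → ∀ u g : GL (Fin 2) (AdeleRing (𝓞 L) L), (u : Matrix (Fin 2) (Fin 2) (AdeleRing (𝓞 L) L)) 1 0 = 0 →
        (u : Matrix (Fin 2) (Fin 2) (AdeleRing (𝓞 L) L)) 0 0 = 1 → (u : Matrix (Fin 2) (Fin 2) (AdeleRing (𝓞 L) L)) 1 1 = 1 → bB s (u * g) = bB s g) ∧
        (∀ s : ℂ, 0 < s.re → ∀ (k : GL (Fin 2) (AdeleRing (𝓞 L) L)) (hk : k ∈ standardMaximalCompactGL 2 L), bB s k = B ⟨k, hk⟩)) ∧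
      (∀ (s : ℂ) (x : X), 0 < s.re → (fun k : ↥(standardMaximalCompactGL 2 L) => φ s x k) ∈ W) ∧
      (∀ z : ℂ, 0 < z.re → ∃ C A r : ℝ, 0 ≤ C ∧ 0 ≤ A ∧ 0 < r ∧ ∀ s : ℂ, dist s z < r →
        ∀ (x : X) (k : ↥(standardMaximalCompactGL 2 L)), ‖φ s x k‖ ≤ C * height x ^ A) := by
  -- the generators `k ↦ a k · c_l(Λ k)`, their span `W₀`, the `B ∩ K`-law subspace `Wlaw`, and `W := W₀ ⊓ Wlaw`
  set gen : ι → (↥(standardMaximalCompactGL 2 L) → ℂ) := fun l k => a k * c l (Λ k) with hgen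
  set W₀ : Submodule ℂ (↥(standardMaximalCompactGL 2 L) → ℂ) := Submodule.span ℂ (Set.range gen) with hW₀
  set Wlaw : Submodule ℂ (↥(standardMaximalCompactGL 2 L) → ℂ) := ⨅ (p : ↥(standardMaximalCompactGL 2 L)) (k : ↥(standardMaximalCompactGL 2 L)) (_ : ((p : GL (Fin 2) (AdeleRing (𝓞 L) L)) : Matrix (Fin 2) (Fin 2) (AdeleRing (𝓞 L) L)) 1 0 = 0),
    LinearMap.ker ((LinearMap.proj (p * k) : (↥(standardMaximalCompactGL 2 L) → ℂ) →ₗ[ℂ] ℂ) - LinearMap.proj k) with hWlaw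
  have hmemlaw : ∀ B : ↥(standardMaximalCompactGL 2 L) → ℂ, B ∈ Wlaw ↔ ∀ p k : ↥(standardMaximalCompactGL 2 L), ((p : GL (Fin 2) (AdeleRing (𝓞 L) L)) : Matrix (Fin 2) (Fin 2) (AdeleRing (𝓞 L) L)) 1 0 = 0 → B (p * k) = B k := by
    intro B
    simp only [hWlaw, Submodule.mem_iInf, LinearMap.mem_ker, LinearMap.sub_apply, LinearMap.coe_proj, Function.eval, sub_eq_zero]
  haveI hfd₀ : FiniteDimensional ℂ W₀ := FiniteDimensional.span_of_finite ℂ (Set.finite_range gen)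
  -- right translation by `k₀` as a linear map
  have hR : ∀ k₀ : ↥(standardMaximalCompactGL 2 L), ∃ R : (↥(standardMaximalCompactGL 2 L) → ℂ) →ₗ[ℂ] (↥(standardMaximalCompactGL 2 L) → ℂ), ∀ B k, R B k = B (k * k₀) := fun k₀ =>
    ⟨LinearMap.funLeft ℂ ℂ (fun k : ↥(standardMaximalCompactGL 2 L) => k * k₀), fun B k => rfl⟩
  -- (1) the generators are continuous and level-invariant, and `W₀` is right-stable
  have hcont₀ : ∀ B ∈ W₀, Continuous B := by
    intro B hB
    induction hB using Submodule.span_induction with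
    | mem x hx =>
      obtain ⟨l, rfl⟩ := hx
      exact ha_cont.mul (hc_cont l)
    | zero => exact continuous_const
    | add x y _ _ hx hy => exact hx.add hy
    | smul r x _ hx => exact continuous_const.mul hx
  have hlev₀ : ∀ B ∈ W₀, ∀ (k : ↥(standardMaximalCompactGL 2 L)) (r : GL (Fin 2) (FiniteAdeleRing (𝓞 L) L)) (hr : r ∈ glFiniteIntegralLevel 2 L),
      (∀ v ∈ S, GLn.evalAt 2 L v r ∈ congruenceGL 2 (γl v)) →
        B ⟨(k : GL (Fin 2) (AdeleRing (𝓞 L) L)) * GLn.ofFinite 2 L r, (standardMaximalCompactGL 2 L).mul_mem k.2 (ofFinite_mem hr)⟩ = B k := by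
    intro B hB k r hr hrS
    induction hB using Submodule.span_induction with
    | mem x hx =>
      obtain ⟨l, rfl⟩ := hx
      show a ((k : GL (Fin 2) (AdeleRing (𝓞 L) L)) * GLn.ofFinite 2 L r) * c l (Λ ((k : GL (Fin 2) (AdeleRing (𝓞 L) L)) * GLn.ofFinite 2 L r)) = a k * c l (Λ k)
      rw [ha_lev k r hr hrS, hc_lev l k r hr hrS]
    | zero => rfl
    | add x y _ _ hx hy => rw [Pi.add_apply, Pi.add_apply, hx, hy]
    | smul t x _ hx => rw [Pi.smul_apply, Pi.smul_apply, hx]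
  have hstab₀ : ∀ B ∈ W₀, ∀ k₀ : ↥(standardMaximalCompactGL 2 L), (fun k => B (k * k₀)) ∈ W₀ := by
    intro B hB k₀
    obtain ⟨R, hRB⟩ := hR k₀
    have hmap : W₀.map R ≤ W₀ := by
      rw [hW₀, Submodule.map_span_le]
      rintro _ ⟨l, rfl⟩
      -- `R (gen l) = Σ_m (a k₀ · M_{lm}(Λ k₀)) • gen m`
      have hEq : R (gen l) = ∑ m, (a k₀ * M l m (Λ k₀)) • gen m := by
        funext k
        rw [hRB, Finset.sum_apply]
        simp only [hgen, Pi.smul_apply, smul_eq_mul]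
        rw [hΛmul, ha_mul, hcM l _ _ (hΛK k₀), Finset.mul_sum]
        exact Finset.sum_congr rfl fun m _ => by ring
      rw [hEq]
      exact Submodule.sum_mem _ fun m _ => Submodule.smul_mem _ _ (Submodule.subset_span ⟨m, rfl⟩)
    have h := hmap (Submodule.mem_map_of_mem hB)
    have hfun : R B = fun k => B (k * k₀) := funext fun k => hRB B k
    rwa [hfun] at h
  -- (2) every `φ(s, x)|_K` lies in `W₀` and has the `B ∩ K`-law
  have hφ₀ : ∀ (s : ℂ) (x : X), 0 < s.re → (fun k : ↥(standardMaximalCompactGL 2 L) => φ s x k) ∈ W₀ := by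
    intro s x hs
    have hEq : (fun k : ↥(standardMaximalCompactGL 2 L) => φ s x k) = ∑ j, ∑ l, (b x * G j s * M j l (kx x)) • gen l := by
      funext k
      rw [Finset.sum_apply, hφ, hF s hs _ (KH.mul_mem (hΛK k) (hkx x))]
      simp only [Finset.sum_apply, hgen, Pi.smul_apply, smul_eq_mul, hcM _ _ _ (hkx x), Finset.mul_sum, Finset.sum_mul]
      exact Finset.sum_congr rfl fun j _ => Finset.sum_congr rfl fun l _ => by ring
    rw [hEq]
    exact Submodule.sum_mem _ fun j _ => Submodule.sum_mem _ fun l _ => Submodule.smul_mem _ _ (Submodule.subset_span ⟨l, rfl⟩)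
  have hφlaw : ∀ (s : ℂ) (x : X), 0 < s.re → (fun k : ↥(standardMaximalCompactGL 2 L) => φ s x k) ∈ Wlaw := by
    intro s x hs
    rw [hmemlaw]
    intro p k hp
    exact borel_compact_law_of_flat (φ s x) (s + 1 / 2) (-(s + 1 / 2)) (hφT s x hs) (hφN s x hs) p k hp
  -- (3) the package
  refine ⟨W₀ ⊓ Wlaw, Submodule.finiteDimensional_of_le inf_le_left, ?_, ?_, ?_, ?_, ?_, ?_, ?_⟩
  · -- hWstab
    intro B hB k₀
    refine Submodule.mem_inf.2 ⟨hstab₀ B (Submodule.mem_inf.1 hB).1 k₀, (hmemlaw _).2 fun p k hp => ?_⟩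
    show B (p * k * k₀) = B (k * k₀)
    rw [mul_assoc]
    exact (hmemlaw B).1 (Submodule.mem_inf.1 hB).2 p (k * k₀) hp
  · -- hWlaw
    intro B hB p k hp
    exact (hmemlaw B).1 (Submodule.mem_inf.1 hB).2 p k hp
  · -- hWlev
    intro B hB k r hr hrS
    exact hlev₀ B (Submodule.mem_inf.1 hB).1 k r hr hrS
  · -- hWcont
    intro B hB
    exact hcont₀ B (Submodule.mem_inf.1 hB).1
  · -- hWext (★ (β0-ext))
    intro B hB
    exact exists_flat_extension B ((hmemlaw B).1 (Submodule.mem_inf.1 hB).2)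
  · -- hφW
    intro s x hs
    exact Submodule.mem_inf.2 ⟨hφ₀ s x hs, hφlaw s x hs⟩
  · -- hφbd: on the half-ball `dist s z < re z ∕ 2`
    intro z hz
    -- bounds of the scalar families on the half-ball
    choose CG hCG0 hCG using fun j => exists_bound_of_continuousOn_halfBall (hG j) hz
    have hCa0 : 0 ≤ Ca := (norm_nonneg _).trans (hCa 1)
    -- `‖F s (Λ k · k_x)‖ ≤ CF` on the half-ball
    set CF : ℝ := ∑ j, (∑ _l : ι, max CM 0 * max Cc 0) * CG j with hCF
    have hCc0 : 0 ≤ ∑ _l : ι, max CM 0 * max Cc 0 := Finset.sum_nonneg fun l _ => mul_nonneg (le_max_right _ _) (le_max_right _ _)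
    have hCF0 : 0 ≤ CF := Finset.sum_nonneg fun j _ => mul_nonneg hCc0 (hCG0 j)
    refine ⟨Ca * CF * max C₀ 0, A₀, z.re / 2, mul_nonneg (mul_nonneg hCa0 hCF0) (le_max_right _ _), hA₀, half_pos hz, fun s hs x k => ?_⟩
    have hs' : dist s z ≤ z.re / 2 := hs.le
    have hsre : 0 < s.re := lt_of_lt_of_le (half_pos hz) (re_half_lt_re_of_dist_le hs')
    have hFb : ‖F s (Λ k * kx x)‖ ≤ CF := by
      rw [hF s hsre _ (KH.mul_mem (hΛK k) (hkx x))]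
      refine (norm_sum_le _ _).trans (Finset.sum_le_sum fun j _ => ?_)
      rw [norm_mul]
      refine mul_le_mul ?_ (hCG j s hs') (norm_nonneg _) hCc0
      rw [hcM _ _ _ (hkx x)]
      refine (norm_sum_le _ _).trans (Finset.sum_le_sum fun l _ => ?_)
      rw [norm_mul]
      exact mul_le_mul ((hCM j l _ (hkx x)).trans (le_max_left _ _)) ((hCc l k).trans (le_max_left _ _)) (norm_nonneg _) (le_max_right _ _)
    have hbx : ‖b x‖ ≤ max C₀ 0 * height x ^ A₀ :=
      (hb x).trans (mul_le_mul_of_nonneg_right (le_max_left _ _) (Real.rpow_nonneg (hpos x).le _))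
    rw [hφ, norm_mul, norm_mul]
    calc ‖a k‖ * ‖b x‖ * ‖F s (Λ k * kx x)‖ ≤ Ca * (max C₀ 0 * height x ^ A₀) * CF :=
          mul_le_mul (mul_le_mul (hCa k) hbx (norm_nonneg _) hCa0) hFb (norm_nonneg _)
            (mul_nonneg hCa0 (mul_nonneg (le_max_right _ _) (Real.rpow_nonneg (hpos x).le _)))
      _ = Ca * CF * max C₀ 0 * height x ^ A₀ := by ring

end Summit.HodgeConjecture.HodgeConjecture.Cruxes.HLiu418.K2LiuSiegelMiddleTermKTypes

end
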